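import Summits.QuantumFields.BalabanUV.Beta.RemainderExplicitHistoryDiagonalWindowSource

/-!
# RemainderExplicitHistoryDiagonalRateLower — ROAD P3, ORDER-0 PROFILE FAMILY: THE RATE IN THE CUTOFF, LOWER SIDE (NO SMALLNESS) — for two
# infrared-pinned runs (A: `K` steps, B: `K + n` steps, `n ≥ K + 1`) and a tail MINORANT `τ′` of the profile (`τ′(k) ≤ Σ_{a∈[k,N)} ρ(a)` for
# `1 ≤ k`, `N ≥ 2k`, non-increasing), SOME position `j` of the window `[j₀, K]` in the infrared half has `√(K−j₀)·τ′(K) ≤ 8κ₂√b₂(1 + Wγ∕b)·d_j`; for a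
# pinned FAMILY: SOME `m′ ≤ m` has `√m·τ′(n+m) ≤ 8κ₂√b₂(1 + Wγ∕b)·(astar g m′ − invSq g m′ (n+m−m′))` (`1 ≤ m ≤ n+1`) — with the third file,
# the law `astar g m − invSq g m n ≍ √m·tail` is TWO-SIDED for power tails (fourth file of station S-d4p3-g49-1 «the rate in the cutoff»)

Cell `pub-balaban`, β-function sub-cell, BINDER row D4 «RemainderConst leaves for Bałaban's split» (`HOME/BINDER-OWNERS.md`; owner
lineage `b2b-balaban-beta-an4`; this file by co-owner #3 lineage `b2b-balaban-beta-d4-p3`, road P3 «the reduction road», generation 49,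
station S-d4p3-g49-1, fourth file; imports the station's second file `RemainderExplicitHistoryDiagonalWindowSource`; independent of the
third), β-FLOW TEAM duty (1); FREEZE (0) honoured (def-free module in road P3's own `RemainderExplicit*` series; no leaf, no interface, no
Literature file).  SOURCE OF THE SHAPES ONLY: [Balaban1987RG1] (0.20) p. 256, (0.31) and Thm 2 p. 259, §5 p. 298.  Pure real analysis about ONE
explicit toy family (ours).

HONEST FRAMING (page 1 of everything the β sub-cell writes).  *"Discharging BetaPertH makes Bałaban's UV stability UNCONDITIONAL — a real
constructive-QFT result; it is NOT the continuum limit and NOT the Clay problem."*  THIS FILE DISCHARGES NOTHING OF THE KIND.  The second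
file's `window_law_lower` says that SOME position of an infrared-half window carries a discrepancy at least the window's missing-age
functional `𝒯∕(8κ₂√b₂(1 + Wγ∕b))` (generation 48's floor-and-ceiling constants `b₂ = 1∕(g^B_{K+n})² + b + Wγ`, `κ₂ = b₂∕b`; NO smallness of
the feedback: the lower side only uses that the window's coupling discrepancies are `≤ (γ∕b)·max d`).  Here `𝒯` is bounded BELOW by a tail
minorant: once the longer run is long enough (`n ≥ K + 1`) every window position misses ages up to at least twice its index, so
`R(j+n+1) − R(j+1) ≥ τ′(j+1) ≥ τ′(K)` and `𝒯 ≥ τ′(K)·(K−j₀)∕√(K−j₀) = √(K−j₀)·τ′(K)`.  The family form reads the position as an infrared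
distance `m′ ≤ m` and bounds the finite-cutoff discrepancy by the continuum one through generation 47's monotonicity in the cutoff
(`invSq_mono`, `continuum_monotone`).  As in generation 48's two-sided law, the lower side is for the RUNNING MAXIMUM over the infrared
distances `m′ ≤ m` — a single position can be undercut by the damping term of the window identity.  Nothing of Bałaban's (1.22) is asserted
or constructed; row D4 class UNCHANGED (critical-path width 0; instance 0∕1; D4 DISCHARGE NO DATE); NOT B12 Thm 2, NOT BetaPertH, NOT
continuum, NOT Clay.  HONEST DEPENDENCY: continuum YM on T⁴ ⇐ BetaPertH ∧ nine spine estimates (0/9 proved); BetaPertH ⇐ (D1) ∧ (D4) ∧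
CAP+tail; G-an2-4 gates asym, D1 and NE2/3/4.  ABSOLUTE RULE: nothing is cited as a fact.

WHAT IS PROVED ([folklore]; 0 sorry; 0 `def`; hypotheses as in the first two files plus the tail minorant `τ′`).
* §1 **`rate_lower`** (pair form: `j₀ < K ≤ 2j₀+1`, `n ≥ K+1` ⇒ `∃ j ∈ [j₀,K]`, `√(K−j₀)·τ′(K) ≤ 8κ₂√b₂(1+Wγ∕b)·d_j`),
  **`astar_sub_invSq_rate_lower`** (family form: `1 ≤ m ≤ n+1` ⇒ `∃ m′ ≤ m`, `√m·τ′(n+m) ≤ 8κ₂√b₂(1+Wγ∕b)·(astar g m′ − invSq g m′ (n+m−m′))`,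
  `b₂ = 1∕g_IR² + b + Wγ`).
All letters NOT-IN-PRINT; `BetaFlowAsPrinted S` records a Markov β_n only ⇒ no junction of the as-printed interface changes.
-/

noncomputable section

open Finset Filter Topology

namespace Summit.QuantumFields.BalabanUV.Beta.RemainderExplicitHistoryDiagonalRateLower

open Literature.MathematicalPhysics.QuantumFieldTheory.Balaban1983to89
open Literature.MathematicalPhysics.QuantumFieldTheory.Balaban1983to89.FlowStep
open Literature.MathematicalPhysics.QuantumFieldTheory.Balaban1983to89.T4CouplingMatching
open Literature.MathematicalPhysics.QuantumFieldTheory.Balaban1983to89.T4ContinuumCoupling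
open Summit.QuantumFields.BalabanUV.Beta.RemainderExplicitHistoryDiagonalMonotone
open Summit.QuantumFields.BalabanUV.Beta.RemainderExplicitHistoryDiagonalWindow
open Summit.QuantumFields.BalabanUV.Beta.RemainderExplicitHistoryDiagonalWindowSource

variable {β : HBeta} {b γ W : ℝ} {ρ : ℕ → ℝ}

/-! ## §1 The lower side from a tail minorant (no smallness) -/

/-- **RATE, LOWER SIDE (pair form, no smallness).**  Two runs of the order-0 profile family in ]0,γ] (`b > 0`, `ρ ≥ 0`, `Σ_{a<N} ρ_a ≤ W`) —
A: `K` steps, B: `K + n` steps — pinned; a tail MINORANT `τ′`: `τ′(k) ≤ Σ_{a∈[k,N)} ρ(a)` whenever `k ≥ 1`, `N ≥ 2k`; a position `j₀ < K` of the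
infrared half (`K ≤ 2j₀+1`) and `n ≥ K + 1`.  THEN some position `j ∈ [j₀, K]` has
`√(K−j₀)·τ′(K) ≤ 8κ₂√b₂·(1 + Wγ∕b)·(1∕(g^B_{j+n})² − 1∕(g^A_j)²)` (`b₂ = 1∕(g^B_{K+n})² + b + Wγ`, `κ₂ = b₂∕b`): `window_law_lower` with
`𝒯 ≥ Σ_{j∈[j₀,K)} τ′(j+1)∕√(K−j) ≥ τ′(K)·(K−j₀)∕√(K−j₀)`. [cite: Balaban1987RG1, (0.20) p.256, (0.31) and Thm 2 p.259] -/
theorem rate_lower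
    (hβ : ∀ (k : ℕ) (p : Fin (k + 1) → ℝ),
      β k p = b + ∑ i : Fin (k + 1), ρ (k - i) * min (p (Fin.last k)) (|p (Fin.last k) - p i|))
    (hb : 0 < b) (hγ : 0 < γ) (hρ0 : ∀ a, 0 ≤ ρ a) (hρW : ∀ n, ∑ a ∈ range n, ρ a ≤ W) {τ' : ℕ → ℝ}
    (hτ'mono : ∀ k l, k ≤ l → τ' l ≤ τ' k)
    (hτ' : ∀ k N, 1 ≤ k → 2 * k ≤ N → τ' k ≤ ∑ a ∈ range N, ρ a - ∑ a ∈ range k, ρ a)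
    {K n : ℕ} {gA gB : ℕ → ℝ} (hA : RGEqH K β gA) (hB : RGEqH (K + n) β gB)
    (hAbox : ∀ k, k ≤ K → 0 < gA k ∧ gA k ≤ γ) (hBbox : ∀ k, k ≤ K + n → 0 < gB k ∧ gB k ≤ γ) (hpin : gA K = gB (K + n))
    {j₀ : ℕ} (hj₀ : j₀ < K) (hIR : K ≤ 2 * j₀ + 1) (hn : K + 1 ≤ n) :
    ∃ j, j₀ ≤ j ∧ j ≤ K ∧
      Real.sqrt ((K - j₀ : ℕ) : ℝ) * τ' K
        ≤ 8 * ((1 / (gB (K + n)) ^ 2 + (b + W * γ)) / b) * Real.sqrt (1 / (gB (K + n)) ^ 2 + (b + W * γ))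
          * (1 + W * γ / b) * (1 / (gB (j + n)) ^ 2 - 1 / (gA j) ^ 2) := by
  obtain ⟨j, hj1, hj2, hj⟩ := (window_law_lower hβ hb hγ hρ0 hρW hA hB hAbox hBbox hpin hj₀.le hIR).2
  refine ⟨j, hj1, hj2, le_trans ?_ hj⟩
  have hs : (0 : ℝ) < ((K - j₀ : ℕ) : ℝ) := by exact_mod_cast (show 0 < K - j₀ by omega)
  have hss : 0 < Real.sqrt ((K - j₀ : ℕ) : ℝ) := Real.sqrt_pos.2 hs
  -- each window term is at least `τ′(K)∕√(K−j₀)`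
  have hterm : ∀ j' ∈ Ico j₀ K, τ' K / Real.sqrt ((K - j₀ : ℕ) : ℝ)
      ≤ (∑ a ∈ range (j' + n + 1), ρ a - ∑ a ∈ range (j' + 1), ρ a) / Real.sqrt ((K - j' : ℕ) : ℝ) := by
    intro j' hj'
    have hj'' := Finset.mem_Ico.mp hj'
    have hs' : (0 : ℝ) < ((K - j' : ℕ) : ℝ) := by exact_mod_cast (show 0 < K - j' by omega)
    have h1 : τ' K ≤ ∑ a ∈ range (j' + n + 1), ρ a - ∑ a ∈ range (j' + 1), ρ a :=
      (hτ'mono _ _ (by omega)).trans (hτ' (j' + 1) (j' + n + 1) (by omega) (by omega))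
    have h0 : 0 ≤ ∑ a ∈ range (j' + n + 1), ρ a - ∑ a ∈ range (j' + 1), ρ a := by
      linarith [partialSum_mono hρ0 (show j' + 1 ≤ j' + n + 1 by omega)]
    have h2 : Real.sqrt ((K - j' : ℕ) : ℝ) ≤ Real.sqrt ((K - j₀ : ℕ) : ℝ) :=
      Real.sqrt_le_sqrt (by exact_mod_cast (show K - j' ≤ K - j₀ by omega))
    calc τ' K / Real.sqrt ((K - j₀ : ℕ) : ℝ) ≤ (∑ a ∈ range (j' + n + 1), ρ a - ∑ a ∈ range (j' + 1), ρ a)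
          / Real.sqrt ((K - j₀ : ℕ) : ℝ) := div_le_div_of_nonneg_right h1 hss.le
      _ ≤ (∑ a ∈ range (j' + n + 1), ρ a - ∑ a ∈ range (j' + 1), ρ a) / Real.sqrt ((K - j' : ℕ) : ℝ) :=
          div_le_div_of_nonneg_left h0 (Real.sqrt_pos.2 hs') h2
  have hsum := Finset.sum_le_sum hterm
  rw [Finset.sum_const, Nat.card_Ico, nsmul_eq_mul] at hsum
  refine le_trans (le_of_eq ?_) hsum
  have es : Real.sqrt ((K - j₀ : ℕ) : ℝ) * Real.sqrt ((K - j₀ : ℕ) : ℝ) = ((K - j₀ : ℕ) : ℝ) := Real.mul_self_sqrt hs.le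
  rw [div_eq_mul_inv]
  calc Real.sqrt ((K - j₀ : ℕ) : ℝ) * τ' K
      = Real.sqrt ((K - j₀ : ℕ) : ℝ) * τ' K * (Real.sqrt ((K - j₀ : ℕ) : ℝ) * (Real.sqrt ((K - j₀ : ℕ) : ℝ))⁻¹) := by
        rw [mul_inv_cancel₀ hss.ne', mul_one]
    _ = (Real.sqrt ((K - j₀ : ℕ) : ℝ) * Real.sqrt ((K - j₀ : ℕ) : ℝ)) * (τ' K * (Real.sqrt ((K - j₀ : ℕ) : ℝ))⁻¹) := by ring
    _ = ((K - j₀ : ℕ) : ℝ) * (τ' K * (Real.sqrt ((K - j₀ : ℕ) : ℝ))⁻¹) := by rw [es]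

/-- **ROAD P3 — THE RATE, LOWER SIDE, FOR A PINNED FAMILY (no smallness).**  A family `K ↦ g K` of runs of the order-0 profile family in
]0,γ] pinned at one `g_IR` (`b > 0`, `ρ ≥ 0`, `Σ_{a<N} ρ_a ≤ W`) and a tail minorant `τ′` (non-increasing, `τ′(k) ≤ Σ_{a∈[k,N)} ρ(a)` for
`k ≥ 1`, `N ≥ 2k`).  THEN for every infrared distance `m ≥ 1` and cutoff `n ≥ m − 1` SOME `m′ ≤ m` has
`√m·τ′(n+m) ≤ 8κ₂√b₂·(1 + Wγ∕b)·(astar g m′ − invSq g m′ (n+m−m′))` (`b₂ = 1∕g_IR² + b + Wγ`, `κ₂ = b₂∕b`): within infrared distance `m` of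
the pin, the continuum discrepancy at cutoff `≈ n` is at least the tail at `n + m` times `√m`, up to the floor-and-ceiling constants
(the lower side holds for the running maximum over `m′ ≤ m`, as in generation 48's law). [cite: Balaban1987RG1, (0.20) p.256, (0.31) and Thm 2 p.259] -/
theorem astar_sub_invSq_rate_lower
    (hβ : ∀ (k : ℕ) (p : Fin (k + 1) → ℝ),
      β k p = b + ∑ i : Fin (k + 1), ρ (k - i) * min (p (Fin.last k)) (|p (Fin.last k) - p i|))
    (hb : 0 < b) (hγ : 0 < γ) (hρ0 : ∀ a, 0 ≤ ρ a) (hρW : ∀ n, ∑ a ∈ range n, ρ a ≤ W) {τ' : ℕ → ℝ}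
    (hτ'mono : ∀ k l, k ≤ l → τ' l ≤ τ' k)
    (hτ' : ∀ k N, 1 ≤ k → 2 * k ≤ N → τ' k ≤ ∑ a ∈ range N, ρ a - ∑ a ∈ range k, ρ a)
    {g : ℕ → ℕ → ℝ} {gIR : ℝ} (hrun : ∀ K, RGEqH K β (g K)) (hbox : ∀ K i, i ≤ K → 0 < g K i ∧ g K i ≤ γ)
    (hpin : ∀ K, g K K = gIR) {m n : ℕ} (hm : 1 ≤ m) (hmn : m ≤ n + 1) :
    ∃ m', m' ≤ m ∧
      Real.sqrt (m : ℝ) * τ' (n + m)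
        ≤ 8 * ((1 / gIR ^ 2 + (b + W * γ)) / b) * Real.sqrt (1 / gIR ^ 2 + (b + W * γ)) * (1 + W * γ / b)
          * (astar g m' - invSq g m' (n + m - m')) := by
  have hW : 0 ≤ W := by simpa using hρW 0
  set n' : ℕ := n + m + 1 with hn'
  have hpin' : g (n + m) (n + m) = g (n + m + n') (n + m + n') := by rw [hpin, hpin]
  obtain ⟨j, hj1, hj2, hj⟩ := rate_lower hβ hb hγ hρ0 hρW hτ'mono hτ' (hrun (n + m)) (hrun (n + m + n')) (hbox (n + m))
    (hbox (n + m + n')) hpin' (j₀ := n) (by omega) (by omega) (by omega)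
  rw [hpin, show n + m - n = m by omega] at hj
  refine ⟨n + m - j, by omega, hj.trans ?_⟩
  have hmono := invSq_mono hβ hb hρ0 hrun hbox hpin (n + m - j)
  have ht := (continuum_monotone hβ hb hγ hρ0 hρW hrun hbox hpin).1 (n + m - j)
  have e1 : invSq g (n + m - j) (j + n') = 1 / (g (n + m + n') (j + n')) ^ 2 := by
    rw [invSq_def, show j + n' + (n + m - j) = n + m + n' by omega]
  have e2 : invSq g (n + m - j) j = 1 / (g (n + m) j) ^ 2 := by
    rw [invSq_def, show j + (n + m - j) = n + m by omega]
  have h1 : invSq g (n + m - j) (j + n') ≤ astar g (n + m - j) := hmono.ge_of_tendsto ht (j + n')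
  have hgIR : 0 < gIR := by rw [← hpin 0]; exact (hbox 0 0 le_rfl).1
  have hc : 0 ≤ 8 * ((1 / gIR ^ 2 + (b + W * γ)) / b) * Real.sqrt (1 / gIR ^ 2 + (b + W * γ)) * (1 + W * γ / b) := by
    positivity
  rw [show n + m - (n + m - j) = j by omega, ← e2]
  refine mul_le_mul_of_nonneg_left ?_ hc
  rw [← e1]
  linarith

end Summit.QuantumFields.BalabanUV.Beta.RemainderExplicitHistoryDiagonalRateLower

end
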